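import Mathlib.FieldTheory.IsAlgClosed.Basic
import Mathlib.Data.ZMod.Basic
import Literature.NumberTheory.Automorphic.IwahoriGL
import Literature.NumberTheory.Automorphic.Socle
import Literature.NumberTheory.Automorphic.SmoothRepresentation
import Literature.NumberTheory.Automorphic.SmoothRepresentationProofs
import HarnessLib

/-!
# Basic `0`-diagrams for `GL₂(F)` and the Breuil–Paškūnas irreducibility criterion (Thm. 1.2 (ii))

Topic `NumberTheory/Automorphic`.  Vocabulary of the mod `p` representation theory of
`G = GL₂(F)`, `F` a non-archimedean local field, organised around diagrams `(D₀, D₁, r)` — `D₀` a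
smooth representation of `K Z = GL₂(𝒪_F)F^×`, `D₁` a smooth representation of the normalizer
`𝒦₁ = N(F)` of the Iwahori subgroup `I`, `r : D₁ → D₀` an `I Z = I F^×`-equivariant map
(Breuil–Paškūnas, Mem. AMS 216, Def. 9.7; Breuil, ICM 2010, §3.2) — together with ONE named fact,
PROVED here: part (ii) of Breuil–Paškūnas' Thm. 1.2, the irreducibility criterion.  For a basic
`0`-diagram `D = (D₀, D₀^{I₁}, can)` (`D₀` finite-dimensional, `K₁` acting trivially) which is
irreducible (no proper non-zero basic subdiagram), every smooth admissible representation `π` of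
`GL₂(F)` with (a) `soc_K π = soc_K D₀`, (b) `(π^{K₁}, π^{I₁}, can) ⊇ D`, (c) `π` generated by
`D₀`, is irreducible (`BreuilPaskunas2012_basicDiagramIrreducible`, discharged by
`BreuilPaskunas2012_basicDiagramIrreducible_holds`).  It is the case `e = 0` of the memoir's
Thm. 9.12, proved below in subrepresentation form for any smooth `π` over any coefficient field
(`isIrreducible_of_isIrreducibleBasicDiagram`) by the printed one-page argument.

## Proof of the irreducibility criterion (memoir, proof of Thm. 9.12, p. 60, case `e = 0`)

Let `P ≠ 0` be a `G`-subrepresentation of `π`.  Smoothness makes the `K`-orbit of a vector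
finite (`Representation.IsSmooth.finite_image_apply`, `K = GL₂(𝒪_F)` being compact), so `P`
contains a non-zero finite-dimensional `K`-subrepresentation, hence an irreducible one (a
non-zero `K`-subrepresentation of least dimension, `exists_isAtom_le_of_finiteDimensional`),
which lies in `soc_K π ⊆ ι(D₀)` ("`socK D0 = socK π` … Hence `D0 ∩ π′ ≠ 0`").  Thus
`W := ι⁻¹(P)` is a non-zero `K Z`-subrepresentation of `D₀` whose `I₁`-invariants
`W ∩ D₀^{I₁}` are stable under the `𝒦₁`-action `ρ₁` (`ι` being `𝒦₁`-equivariant on `D₀^{I₁}` and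
`P` `G`-stable), i.e. `(W, W^{I₁}, can)` is a non-zero basic subdiagram of `D` ("we obtain that
`K(π′) ∩ D` is basic"); irreducibility of `D` forces `W = D₀`, i.e. `ι(D₀) ⊆ P`, and since `π` is
generated by `ι(D₀)` ("Taking `H₀` …"), `P = π`.  Finally `π ≠ 0` because `D₀ ≠ 0` and `ι` is
injective.

## Deliberately not here (withdrawn at the D-0026 split reviews, 2026-08-15)

* The general realisation theorem for arbitrary diagrams — Breuil, ICM 2010, Thm. 3.4 (`D₀` any
  finite-dimensional smooth representation of `K Z` with a central character, `D₁ ⊆ D₀` any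
  non-zero `I Z`-stable subspace with an `N(F)`-action inducing the `I Z`-action, `p > 2` or `I₁`
  acting trivially on `D₁`), i.e. Breuil–Paškūnas Thm. 9.8 with Lemma 9.9 and Prop. 9.10 after
  an unramified twist — was vendored in this file as a named fact,
  `Breuil2011_diagramRealisation` (ledger p20704), presented as a decomposition node of the
  barrier fact `Literature.Barriers.Langlands.ModPLanglandsGL2BeyondQpFpBar`.  At the split
  review it was checked against both sources (survey pp. 217–218; memoir §9, pp. 55–60 of the
  authors' version: Def. 9.1, Prop. 9.2, Lemmas 9.5–9.6, Def. 9.7, Thm. 9.8, Lemma 9.9,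
  Prop. 9.10) and found faithful, but it had no dependents and no glue to the barrier fact, and
  its printed proof is a theory of its own (injective envelopes in the categories of smooth `K`-
  and `I`-representations and the structure of their `I₁`-invariants, property (S), Paškūnas'
  equivalence between diagrams and `G`-equivariant coefficient systems on the tree, [25, §§4–6]
  of the memoir): not a dischargeable decomposition child.  It was therefore withdrawn and
  merged back into the (unproved, SIZE XL) obligation of the barrier fact, whose docstring
  records the chain of printed results it rests on.  Re-vendor the statement through a cite
  item if a route comes to need it.
* Part (i) of Breuil–Paškūnas' Thm. 1.2 — the EXISTENCE of a smooth admissible `π` with (a),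
  (b), (c) for every basic `0`-diagram with `D₀` finite-dimensional and `K₁` acting trivially
  ("a special case of Theorem 9.8 by taking `π` to be the `G`-subrepresentation generated by
  `D₀`", §1 p. 7) — was vendored here bundled with part (ii) in one named fact,
  `BreuilPaskunas2012_basicDiagramRealisation` (ledger p21815, faithful to the print, no
  dependents).  As a decomposition child that `Prop` was mis-cut: (ii) is the one-page argument
  above, whereas (i) is Thm. 9.8 again (injective envelopes `Inj_K soc_K D₀` and their
  restriction to `I`, the extension of the `I`-action to `𝒦₁` of Lemmas 9.5–9.6 resting on
  [25, Lem. 6.4.1, 4.2.19, 4.2.20], and the amalgam `G = K Z *_{I Z} 𝒦₁` of [25, §5]).  At the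
  split review of that fact it was RESTATED as `BreuilPaskunas2012_basicDiagramIrreducible`
  (part (ii): same cite, same rendering, same standing hypotheses) and proved; part (i) was
  withdrawn with the same destination as the previous item (the obligation of the barrier fact,
  via Thm. 19.8 (i) of the memoir), D-0026 allowing no unproved fact without a dependent.

## Definitions (all with bodies)

* `glIntCenter F n = GL_n(𝒪_F) · Z` (`= glInt n F ⊔ center`, Breuil's `GL₂(𝒪_F)F^×`,
  Breuil–Paškūnas' `K₀ = KZ`) and `iwahoriCenter F n = I · Z` (`= iwahoriGL n F ⊔ center`,
  `IF^×`), with the inclusions `I Z ≤ K Z`, `I Z ≤ N(F)` (`iwahoriNormalizerGL`, the normalizer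
  of `I`, file `IwahoriGL`), `Z ≤ K Z`, `I₁ ≤ K Z`.
* `scalar_mem_center` / `scalar_mem_glIntCenter` (Mathlib's `Matrix.GeneralLinearGroup.scalar`,
  the central elements `u · 1`, lie in `Z ≤ K Z`), `congruenceOneGL F n = K₁`
  (`1 + 𝓂 M_n(𝒪_F)`, the pro-unipotent radical of the one-block parahoric), `proPIwahoriIn F n`
  (`I₁` as a subgroup of `K Z`, to form `D₀^{I₁} = D₀.fixedPoints _`), and
  `IsIrreducibleBasicDiagram D₀ ρ₁` (Breuil–Paškūnas' irreducible basic `0`-diagrams, §1 p. 6,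
  §9 p. 59).

## Main statements (all proved)

* `exists_isAtom_le_of_finiteDimensional`: a non-zero subrepresentation with finite-dimensional
  carrier contains an irreducible (atomic) one.
* `exists_finiteDimensional_subrepresentation_of_isSmooth`, `exists_isAtom_le_of_isSmooth`: in a
  smooth representation the `K`-orbit of a vector spans a finite-dimensional
  `K`-subrepresentation (`K` with compact carrier), so every non-zero `G`-subrepresentation
  meets the `K`-socle.
* `isIrreducible_of_isIrreducibleBasicDiagram`: BP Thm. 9.12 for `e = 0` (any smooth `π`, any
  coefficient field, `soc_K π ⊆ ι(D₀)` in place of (a)).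
* `BreuilPaskunas2012_basicDiagramIrreducible` (named fact, BP Thm. 1.2 (ii) as printed) and its
  discharge `BreuilPaskunas2012_basicDiagramIrreducible_holds`.

## References

* C. Breuil, *The emerging p-adic Langlands programme*, Proc. ICM 2010 Vol. II (2011) 203–230,
  §3.2 (the subgroups `GL₂(𝒪_F)F^×`, `IF^×`, `N(F)`, diagrams `(D₀, D₁)`; Thm. 3.4 and the
  paragraph following it, pp. 217–218, for the withdrawn fact). [cite: Breuil2011, §3.2]
* C. Breuil, V. Paškūnas, *Towards a modulo p Langlands correspondence for GL₂*, Mem. AMS 216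
  (2012), §1 p. 12 (notation `K`, `K_m`, `I_m`, `K₀ = KZ`, `𝔎₁` = normalizer of `I`, fixed `ϖ`,
  coefficients `𝔽̄_p`), §9 Def. 9.7 (diagrams), Thm. 9.8 (the general realisation theorem, for
  the withdrawn facts). [cite: BreuilPaskunas2012, §9]
* op. cit., §1 pp. 6–7: basic `0`-diagrams, irreducible ones, Thm. 1.2 (i)–(ii) ("works for any
  local field `F` with finite residue field"); §9 p. 59 (basic diagrams, `0`-irreducible),
  Thm. 9.12 and its proof p. 60 (page numbers of the authors' version, `supersingular.pdf`,
  122 pp.). [cite: BreuilPaskunas2012, Thm. 1.2] [cite: BreuilPaskunas2012, Thm. 9.12]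
-/

open scoped ValuativeRel

universe u

namespace Literature.NumberTheory.Automorphic

/-! ### The subgroups `K Z` and `I Z` -/

section Subgroups

variable (F : Type u) [Field F] [ValuativeRel F] (n : ℕ)

/-- The subgroup `K Z = GL_n(𝒪_F) · F^× ≤ GL_n(F)` generated by the integral points and the
centre (Breuil's `GL₂(𝒪_F)F^×`, Breuil–Paškūnas' `K₀ := KZ`; the two subgroups commute, so the
join is the product set). (Breuil ICM 2010, §3.2; Breuil–Paškūnas §1 p. 12.) [cite: Breuil2011, §3.2] -/
noncomputable abbrev glIntCenter : Subgroup (GL (Fin n) F) :=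
  glInt n F ⊔ Subgroup.center (GL (Fin n) F)

/-- The subgroup `I Z = I · F^× ≤ GL_n(F)` generated by the Iwahori subgroup and the centre
(Breuil's `IF^×`, Breuil–Paškūnas' `IZ`). (Breuil ICM 2010, §3.2.) [cite: Breuil2011, §3.2] -/
noncomputable abbrev iwahoriCenter : Subgroup (GL (Fin n) F) :=
  iwahoriGL n F ⊔ Subgroup.center (GL (Fin n) F)

/-- `I Z ≤ K Z`. [folklore] -/
theorem iwahoriCenter_le_glIntCenter : iwahoriCenter F n ≤ glIntCenter F n :=
  sup_le_sup_right (iwahoriGL_le_glInt n F) _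

/-- `I Z ≤ N(F)`, the normalizer of the Iwahori subgroup. [folklore] -/
theorem iwahoriCenter_le_iwahoriNormalizerGL : iwahoriCenter F n ≤ iwahoriNormalizerGL n F :=
  sup_le (iwahoriGL_le_iwahoriNormalizerGL n F) (center_le_iwahoriNormalizerGL n F)

/-- `Z ≤ K Z`. [folklore] -/
theorem center_le_glIntCenter : Subgroup.center (GL (Fin n) F) ≤ glIntCenter F n := le_sup_right

/-- `GL_n(𝒪_F) ≤ K Z`. [folklore] -/
theorem glInt_le_glIntCenter : glInt n F ≤ glIntCenter F n := le_sup_left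

/-- `I₁ ≤ K Z`. [folklore] -/
theorem proPIwahoriGL_le_glIntCenter : proPIwahoriGL n F ≤ glIntCenter F n :=
  ((proPIwahoriGL_le_iwahoriGL n F).trans (iwahoriGL_le_glInt n F)).trans (glInt_le_glIntCenter F n)

end Subgroups


/-! ### Scalar matrices in `K Z`, the first congruence subgroup, basic `0`-diagrams -/

section Basic

variable (F : Type u) [Field F] [ValuativeRel F] (n : ℕ)

omit [ValuativeRel F] in
/-- The scalar matrices `u · 1 = Matrix.GeneralLinearGroup.scalar (Fin n) u` (`u ∈ F^×`, Mathlib)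
are central in `GL_n(F)` (`Matrix.GeneralLinearGroup.scalar_commute`). [folklore] -/
theorem scalar_mem_center (u : Fˣ) :
    Matrix.GeneralLinearGroup.scalar (Fin n) u ∈ Subgroup.center (GL (Fin n) F) :=
  Subgroup.mem_center_iff.2 fun g => (Matrix.GeneralLinearGroup.scalar_commute u g).symm

/-- Scalar matrices lie in `K Z`. [folklore] -/
theorem scalar_mem_glIntCenter (u : Fˣ) :
    Matrix.GeneralLinearGroup.scalar (Fin n) u ∈ glIntCenter F n :=
  center_le_glIntCenter F n (scalar_mem_center F n u)

/-- The **first congruence subgroup** `K₁ = 1 + 𝓂 M_n(𝒪_F) = ker(GL_n(𝒪_F) → GL_n(𝓀))`: the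
pro-unipotent radical of the parahoric with one block (`proUnipotentGL` for a constant
labelling; membership: `g ∈ GL_n(𝒪)` and `g ≡ 1 mod 𝓂`, `mem_proUnipotentGL_iff`).
(Breuil–Paškūnas §1 p. 12: "`K_m := 1 + 𝔭_F^m M₂`"; here `m = 1`.) [cite: BreuilPaskunas2012, §1] -/
noncomputable abbrev congruenceOneGL : Subgroup (GL (Fin n) F) :=
  proUnipotentGL n F (fun _ : Fin n => (0 : Fin 1))

/-- `K₁ ≤ GL_n(𝒪_F)`. [folklore] -/
theorem congruenceOneGL_le_glInt : congruenceOneGL F n ≤ glInt n F :=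
  proUnipotentGL_le_glInt n F _

/-- `K₁ ≤ K Z`. [folklore] -/
theorem congruenceOneGL_le_glIntCenter : congruenceOneGL F n ≤ glIntCenter F n :=
  (congruenceOneGL_le_glInt F n).trans (glInt_le_glIntCenter F n)

/-- The pro-`p` Iwahori subgroup `I₁` viewed inside `K Z` (`Subgroup.subgroupOf`), so that the
`I₁`-invariants `D₀^{I₁}` of a representation `D₀` of `K Z` are `D₀.fixedPoints (proPIwahoriIn F n)`.
[folklore] -/
noncomputable abbrev proPIwahoriIn : Subgroup (glIntCenter F n) :=
  (proPIwahoriGL n F).subgroupOf (glIntCenter F n)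

variable {F}
variable {k : Type*} [Field k] {V₀ : Type*} [AddCommGroup V₀] [Module k V₀]

/-- **Irreducibility of a basic `0`-diagram** `(D₀, D₁ = D₀^{I₁}, can)` (`D₀` a representation of
`K Z = GL₂(𝒪_F)F^×`, `ρ₁` an action of the normalizer `N(F)` of the Iwahori on `D₁ = D₀^{I₁}`):
Breuil–Paškūnas call a basic `0`-diagram irreducible "if it doesn't contain any non-zero strict
basic subdiagram (in the obvious sense)" (§1 p. 6; §9 p. 59: "`0`-irreducible … if it does not
contain any proper non-zero basic subdiagrams").  A basic subdiagram is `(D₀', D₁', can)` with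
`D₀' ⊆ D₀` a `K Z`-subrepresentation and `D₁' = D₀'^{I₁} = D₀' ∩ D₁` an `N(F)`-subrepresentation
of `D₁`; it is zero iff `D₀' = 0` and strict iff `D₀' ≠ D₀`.  Hence: `D₀ ≠ 0` (an irreducible
object is non-zero — the memoir only ever speaks of "proper non-zero" subdiagrams and never calls
the zero diagram irreducible; without this clause part (ii) of Thm. 1.2 would make the zero
representation irreducible) and every `K Z`-subrepresentation `W ⊆ D₀` such that `W ∩ D₀^{I₁}`
is stable under `ρ₁(N(F))` is `⊥` or `⊤`.
[cite: BreuilPaskunas2012, §9 (p. 59, `0`-irreducible basic diagrams)] -/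
def IsIrreducibleBasicDiagram (D₀ : Representation k (glIntCenter F 2) V₀)
    (ρ₁ : Representation k (iwahoriNormalizerGL 2 F) (D₀.fixedPoints (proPIwahoriIn F 2))) :
    Prop :=
  Nontrivial V₀ ∧
  ∀ W : Subrepresentation D₀,
    (∀ (g : iwahoriNormalizerGL 2 F) (v : D₀.fixedPoints (proPIwahoriIn F 2)),
        (v : V₀) ∈ W.toSubmodule → ((ρ₁ g v : D₀.fixedPoints (proPIwahoriIn F 2)) : V₀) ∈
          W.toSubmodule) →
    W = ⊥ ∨ W = ⊤

end Basic

/-! ### Irreducible subrepresentations inside finite-dimensional ones -/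

section Atoms

variable {k G V : Type*} [Field k] [Monoid G] [AddCommGroup V] [Module k V]
  {ρ : Representation k G V}

/-- A non-zero subrepresentation with finite-dimensional carrier contains an irreducible
(= atomic) subrepresentation: a non-zero subrepresentation below it of least dimension is an
atom of the lattice `Subrepresentation ρ`. [folklore] -/
theorem exists_isAtom_le_of_finiteDimensional (W : Subrepresentation ρ)
    (hfin : FiniteDimensional k W.toSubmodule) (hW : W ≠ ⊥) :
    ∃ A : Subrepresentation ρ, IsAtom A ∧ A ≤ W := by
  suffices h : ∀ (n : ℕ) (W : Subrepresentation ρ), FiniteDimensional k W.toSubmodule →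
      W ≠ ⊥ → Module.finrank k W.toSubmodule = n →
        ∃ A : Subrepresentation ρ, IsAtom A ∧ A ≤ W from
    h _ W hfin hW rfl
  intro n
  induction n using Nat.strong_induction_on with
  | _ n ih =>
    intro W hfin hW hn
    by_cases hA : IsAtom W
    · exact ⟨W, hA, le_rfl⟩
    · have h' : ∃ W' : Subrepresentation ρ, W' < W ∧ W' ≠ ⊥ := by
        by_contra hcon
        push Not at hcon
        exact hA ⟨hW, fun W' hW' => hcon W' hW'⟩
      obtain ⟨W', hlt, hne⟩ := h'
      have hle : W'.toSubmodule ≤ W.toSubmodule := fun x hx => hlt.le hx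
      have hne' : W'.toSubmodule ≠ W.toSubmodule := fun h => hlt.ne (Subrepresentation.ext h)
      have hlt' : W'.toSubmodule < W.toSubmodule := lt_of_le_of_ne hle hne'
      haveI := hfin
      have hfin' : FiniteDimensional k W'.toSubmodule := Submodule.finiteDimensional_of_le hle
      have hrank : Module.finrank k W'.toSubmodule < n :=
        hn ▸ Submodule.finrank_lt_finrank_of_lt hlt'
      obtain ⟨A, hAat, hAle⟩ := ih _ hrank W' hfin' hne rfl
      exact ⟨A, hAat, hAle.trans hlt.le⟩

end Atoms

/-! ### Smooth representations: finite-dimensional `K`-subrepresentations through a vector -/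

section Orbit

variable {k G V : Type*} [Field k] [Group G] [TopologicalSpace G] [SeparatelyContinuousMul G]
  [AddCommGroup V] [Module k V] {π : Representation k G V}

/-- In a smooth representation, every vector lies in a finite-dimensional subrepresentation of
any subgroup `K` with compact carrier: the span of its `K`-orbit, which is finite
(`Representation.IsSmooth.finite_image_apply`).  (Breuil–Paškūnas use it tacitly: a non-zero
smooth representation of `K` has a non-zero `K`-socle, proof of Thm. 9.12.) [folklore] -/
theorem exists_finiteDimensional_subrepresentation_of_isSmooth (hπ : π.IsSmooth)
    (K : Subgroup G) (hK : IsCompact (K : Set G)) (v : V) :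
    ∃ M : Subrepresentation (π.comp K.subtype),
      v ∈ M.toSubmodule ∧ FiniteDimensional k M.toSubmodule := by
  set S : Set V := (fun g : G => π g v) '' (K : Set G) with hS
  have hfin : S.Finite := hπ.finite_image_apply hK v
  have hstab : ∀ g : K, S ⊆ (Submodule.span k S).comap (π (g : G)) := by
    rintro g _ ⟨g', hg', rfl⟩
    simp only [SetLike.mem_coe, Submodule.mem_comap]
    refine Submodule.subset_span ⟨(g : G) * g', K.mul_mem g.2 hg', ?_⟩
    simp only [map_mul, Module.End.mul_apply]
  refine ⟨⟨Submodule.span k S, fun g x hx => ?_⟩, ?_, ?_⟩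
  · show π (g : G) x ∈ Submodule.span k S
    exact Submodule.mem_comap.1 (Submodule.span_le.2 (hstab g) hx)
  · exact Submodule.subset_span ⟨1, K.one_mem, by simp⟩
  · exact FiniteDimensional.span_of_finite k hfin

/-- In a smooth representation of `G`, every non-zero `G`-subrepresentation `P` contains an
irreducible `K`-subrepresentation, for any subgroup `K` with compact carrier; in particular `P`
meets the `K`-socle of `π` non-trivially (`Representation.le_socle_of_isAtom`). [folklore] -/
theorem exists_isAtom_le_of_isSmooth (hπ : π.IsSmooth) (K : Subgroup G)
    (hK : IsCompact (K : Set G)) (P : Subrepresentation π) (hP : P ≠ ⊥) :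
    ∃ A : Subrepresentation (π.comp K.subtype), IsAtom A ∧ A.toSubmodule ≤ P.toSubmodule := by
  have hP' : P.toSubmodule ≠ ⊥ := fun h => hP (Subrepresentation.ext h)
  obtain ⟨w, hwP, hw0⟩ := Submodule.exists_mem_ne_zero_of_ne_bot hP'
  obtain ⟨M, hwM, hMfin⟩ := exists_finiteDimensional_subrepresentation_of_isSmooth hπ K hK w
  -- `P` viewed as a `K`-subrepresentation
  let PK : Subrepresentation (π.comp K.subtype) :=
    ⟨P.toSubmodule, fun g x hx => P.apply_mem_toSubmodule (g : G) hx⟩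
  haveI := hMfin
  have hfin' : FiniteDimensional k (M ⊓ PK).toSubmodule :=
    Submodule.finiteDimensional_of_le (fun x hx => (Submodule.mem_inf.1 hx).1)
  have hne : M ⊓ PK ≠ ⊥ := by
    intro h
    have hw : w ∈ (M ⊓ PK).toSubmodule := Submodule.mem_inf.2 ⟨hwM, hwP⟩
    rw [h] at hw
    exact hw0 ((Submodule.mem_bot k).1 hw)
  obtain ⟨A, hA, hAle⟩ := exists_isAtom_le_of_finiteDimensional (M ⊓ PK) hfin' hne
  exact ⟨A, hA, fun x hx => (Submodule.mem_inf.1 (hAle hx)).2⟩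

end Orbit

/-! ### Breuil–Paškūnas, Thm. 1.2 (ii) = Thm. 9.12 (`e = 0`): irreducible basic `0`-diagrams -/

/-- **Irreducibility criterion of Breuil–Paškūnas (Thm. 9.12 for `e = 0`, subrepresentation
form; any `F`, any coefficient field).**  Thm. 9.12 as printed (§9 p. 59): "Let `D` be a basic
`e`-irreducible diagram with `e ≥ 0` and suppose that we are given an injection of diagrams
`ι : D ↪ K(Ω)` where `Ω` is a smooth representation of `G` such that `soc_K Ω ≅ soc_K D₀`.  Then
the image of `H₀(ι) : H₀(D) → Ω` is an irreducible representation of `G`."  Here, for `e = 0`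
and the basic `0`-diagram `D = (D₀, D₀^{I₁}, can)` with `𝒦₁`-action `ρ₁` on `D₀^{I₁}`
(`IsIrreducibleBasicDiagram D₀ ρ₁`: `D₀ ≠ 0` and no proper non-zero basic subdiagram): if `π` is
a smooth representation of `G = GL₂(F)`, `ι : D₀ ↪ π` is an injective `K Z`-equivariant linear
map which is `𝒦₁`-equivariant on `D₀^{I₁}` (an injection of diagrams `D ↪ K(π)`), the `K`-socle
of `π` lies in `ι(D₀)` (implied by `soc_K π = ι(soc_K D₀)`, the printed hypothesis read through
`ι`, cf. "`socK D0 = socK π = socK Ω`" in the proof) and `π` is generated by `ι(D₀)` (i.e. `π`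
is the image of `H₀(D) → Ω`), then `π` is irreducible.  The hypotheses "`ϖ` acts trivially",
"`D₀` smooth / finite-dimensional" of a basic diagram are not needed for this implication and
are not assumed.  Proof: the printed one (p. 60), see the module docstring; the only input
beyond the definitions is that a non-zero `G`-subrepresentation of a smooth `π` meets `soc_K π`
(`exists_isAtom_le_of_isSmooth`, `K = GL₂(𝒪_F)` compact). [cite: BreuilPaskunas2012, Thm. 9.12] -/
theorem isIrreducible_of_isIrreducibleBasicDiagram
    {F : Type*} [Field F] [ValuativeRel F] [TopologicalSpace F] [IsNonarchimedeanLocalField F]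
    {k : Type*} [Field k] {V₀ : Type*} [AddCommGroup V₀] [Module k V₀]
    {D₀ : Representation k (glIntCenter F 2) V₀}
    {ρ₁ : Representation k (iwahoriNormalizerGL 2 F) (D₀.fixedPoints (proPIwahoriIn F 2))}
    (hD : IsIrreducibleBasicDiagram D₀ ρ₁)
    {V : Type*} [AddCommGroup V] [Module k V] (π : Representation k (GL (Fin 2) F) V)
    (hπ : π.IsSmooth) (ι : V₀ →ₗ[k] V) (hι : Function.Injective ι)
    (hι₀ : ∀ (g : glIntCenter F 2) (v : V₀), ι (D₀ g v) = π g (ι v))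
    (hι₁ : ∀ (g : iwahoriNormalizerGL 2 F) (v : D₀.fixedPoints (proPIwahoriIn F 2)),
        ι (ρ₁ g v : D₀.fixedPoints (proPIwahoriIn F 2)) = π g (ι v))
    (hsoc : (Representation.socle (π.comp (glInt 2 F).subtype)).toSubmodule ≤ LinearMap.range ι)
    (hgen : Submodule.span k (Set.range fun gv : GL (Fin 2) F × V₀ => π gv.1 (ι gv.2)) = ⊤) :
    π.IsIrreducible := by
  haveI : IsTopologicalRing F := inferInstance
  obtain ⟨hV₀, hW⟩ := hD
  -- `π ≠ 0`, as `D₀ ≠ 0` embeds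
  have hbt : (⊥ : Subrepresentation π) ≠ ⊤ := by
    intro h
    obtain ⟨v, hv⟩ := exists_ne (0 : V₀)
    have hmem : ι v ∈ (⊤ : Subrepresentation π).toSubmodule := Submodule.mem_top
    rw [← h] at hmem
    have h0 : ι v = 0 := (Submodule.mem_bot k).1 hmem
    exact hv (hι (by rw [h0, map_zero]))
  haveI : Nontrivial (Subrepresentation π) := ⟨⟨⊥, ⊤, hbt⟩⟩
  refine ⟨fun P => ?_⟩
  by_cases hP : P = ⊥
  · exact Or.inl hP
  right
  -- a non-zero `G`-subrepresentation `P` meets `soc_K π ⊆ ι(D₀)`: "`D₀ ∩ π′ ≠ 0`"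
  obtain ⟨A, hA, hAle⟩ :=
    exists_isAtom_le_of_isSmooth hπ (glInt 2 F) (isCompact_glInt 2 F) P hP
  have hA' : A.toSubmodule ≠ ⊥ := fun h => hA.1 (Subrepresentation.ext h)
  obtain ⟨a, haA, ha0⟩ := Submodule.exists_mem_ne_zero_of_ne_bot hA'
  have haP : a ∈ P.toSubmodule := hAle haA
  have hasoc : a ∈ (Representation.socle (π.comp (glInt 2 F).subtype)).toSubmodule :=
    Representation.le_socle_of_isAtom _ hA haA
  obtain ⟨v, rfl⟩ := hsoc hasoc
  -- `W' = ι⁻¹(P)` is a `K Z`-subrepresentation of `D₀` with `𝒦₁`-stable `I₁`-invariants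
  -- ("`K(π′) ∩ D` is basic"), non-zero, hence everything
  let W' : Subrepresentation D₀ :=
    ⟨P.toSubmodule.comap ι, fun g x hx => by
      simp only [Submodule.mem_comap] at hx ⊢
      rw [hι₀]
      exact P.apply_mem_toSubmodule _ hx⟩
  have hW'stab : ∀ (g : iwahoriNormalizerGL 2 F) (x : D₀.fixedPoints (proPIwahoriIn F 2)),
      (x : V₀) ∈ W'.toSubmodule →
        ((ρ₁ g x : D₀.fixedPoints (proPIwahoriIn F 2)) : V₀) ∈ W'.toSubmodule := by
    intro g x hx
    simp only [W', Submodule.mem_comap] at hx ⊢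
    rw [hι₁]
    exact P.apply_mem_toSubmodule _ hx
  have hW'top : W' = ⊤ := by
    rcases hW W' hW'stab with h | h
    · exfalso
      have hvW : v ∈ W'.toSubmodule := haP
      rw [h] at hvW
      have hv0 : v = 0 := (Submodule.mem_bot k).1 hvW
      exact ha0 (by rw [hv0, map_zero])
    · exact h
  have hιP : ∀ x : V₀, ι x ∈ P.toSubmodule := fun x => by
    have hx : x ∈ W'.toSubmodule := by rw [hW'top]; exact Submodule.mem_top
    exact hx
  -- `π` is generated by `ι(D₀) ⊆ P` ("Taking `H₀` … `π = π′`")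
  apply Subrepresentation.ext
  refine eq_top_iff.2 ?_
  rw [← hgen]
  refine Submodule.span_le.2 ?_
  rintro _ ⟨⟨g, x⟩, rfl⟩
  exact P.apply_mem_toSubmodule g (hιP x)

/-- **Breuil–Paškūnas, Thm. 1.2 (ii)** (§1 p. 6–7; "it has nothing to do with `F` unramified over
`ℚ_p` and works for any local field `F` with finite residue field, see §9"; (ii) is Thm. 9.12 for
`e = 0`).  As printed: "Let us call a basic `0`-diagram any triple `D := (D₀, D₁, r)` where `D₀`
is a smooth representation of `GL₂(𝒪_F)F^×` over `𝔽̄_p` such that `p ∈ F^×` acts trivially [for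
general `F`: the fixed uniformizer `ϖ`, §1 p. 12, §9], `D₁` a smooth representation of `𝒦₁` [the
normalizer of `I` in `G`, §1 p. 12] over `𝔽̄_p` and `r : D₁ ↪ D₀` an injection inducing an
`IF^×`-equivariant isomorphism `D₁ ≅ D₀^{I₁}` … Let us say that a basic `0`-diagram is
irreducible if it doesn't contain any non-zero strict basic subdiagram (in the obvious sense).
Theorem 1.2. Let `D = (D₀, D₁, r)` be a basic `0`-diagram such that `D₀` is finite dimensional
and `K₁` acts trivially on `D₀`. (i) There exists at least one smooth admissible representation
`π` of `GL₂(F)` over `𝔽̄_p` such that: (a) `soc_K π = soc_K D₀` (b) `(π^{K₁}, π^{I₁}, can)`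
contains `D` (c) `π` is generated by `D₀`. (ii) Assume `D` is irreducible. Then any `π`
satisfying (a), (b), (c) of (i) is irreducible."  THIS `Prop` IS PART (ii), with the standing
hypotheses of the theorem; part (i), the existence theorem ("a special case of Theorem 9.8"), is
not vendored (see the module docstring, § Deliberately not here).  Rendering: `F` any
non-archimedean local field
(`IsNonarchimedeanLocalField`, either characteristic) with residue characteristic `p`;
coefficients an algebraic closure `k` of `𝔽_p`; `K = glInt 2 F`, `K Z = glIntCenter F 2`,
`K₁ = congruenceOneGL F 2`, `I₁ = proPIwahoriGL 2 F`, `IF^× = iwahoriCenter F 2`,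
`𝒦₁ = iwahoriNormalizerGL 2 F`; by transport of structure along `r` one may take
`D₁ = D₀^{I₁} = D₀.fixedPoints (proPIwahoriIn F 2)` with `r` the inclusion and the `𝒦₁`-action
`ρ₁` on it restricting to the `IF^×`-action of `D₀` (smoothness of `ρ₁` is then automatic, `IF^×`
being open in `𝒦₁`); "`ϖ` acts trivially" = the scalar matrix
`Matrix.GeneralLinearGroup.scalar (Fin 2) ϖ` of some uniformizer `ϖ` acts as the identity;
(b) "contains `D`" = an injection of diagrams, i.e. an injective `K Z`-equivariant `ι : D₀ → π`
(its image lies in `π^{K₁}` because `K₁` acts trivially on `D₀`) which is `𝒦₁`-equivariant on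
`D₁` (image in `π^{I₁}`), the square with `can` and `r` commuting by construction; (a) compares
the `K`-socles (`Representation.socle` of the restrictions to `K = GL₂(𝒪_F)`) through `ι`; (c) is
`span_k {π g (ι v)} = π`; "irreducible" for `D` is `IsIrreducibleBasicDiagram`, for `π`
Mathlib's `Representation.IsIrreducible`; (ii) is recorded for smooth admissible `π`, the `π` of
(i) (the literal reading of "any `π` satisfying (a), (b), (c) of (i)"; Thm. 9.12, i.e.
`isIrreducible_of_isIrreducibleBasicDiagram`, gives it for any smooth `π`).  Named fact,
DISCHARGED below (`BreuilPaskunas2012_basicDiagramIrreducible_holds`).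
[cite: BreuilPaskunas2012, Thm. 1.2] -/
def BreuilPaskunas2012_basicDiagramIrreducible : Prop :=
  ∀ (p : ℕ) [Fact p.Prime] (F : Type) [Field F] [ValuativeRel F] [TopologicalSpace F]
      [IsNonarchimedeanLocalField F], CharP 𝓀[F] p →
  ∀ (k : Type) [Field k] [Algebra (ZMod p) k] [IsAlgClosure (ZMod p) k]
    (V₀ : Type) [AddCommGroup V₀] [Module k V₀] [FiniteDimensional k V₀]
    (D₀ : Representation k (glIntCenter F 2) V₀),
    D₀.IsSmooth →
    (∃ ϖ : Fˣ, (∃ hϖ : (ϖ : F) ∈ 𝒪[F], 𝓂[F] = Ideal.span {(⟨(ϖ : F), hϖ⟩ : 𝒪[F])}) ∧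
        D₀ ⟨Matrix.GeneralLinearGroup.scalar (Fin 2) ϖ, scalar_mem_glIntCenter F 2 ϖ⟩ =
          LinearMap.id) →
    (∀ g : congruenceOneGL F 2, D₀ ⟨g, congruenceOneGL_le_glIntCenter F 2 g.2⟩ = LinearMap.id) →
  ∀ (ρ₁ : Representation k (iwahoriNormalizerGL 2 F) (D₀.fixedPoints (proPIwahoriIn F 2))),
    (∀ (g : iwahoriCenter F 2) (v : D₀.fixedPoints (proPIwahoriIn F 2)),
        ((ρ₁ ⟨g, iwahoriCenter_le_iwahoriNormalizerGL F 2 g.2⟩ v :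
            D₀.fixedPoints (proPIwahoriIn F 2)) : V₀) =
          D₀ ⟨g, iwahoriCenter_le_glIntCenter F 2 g.2⟩ v) →
    IsIrreducibleBasicDiagram D₀ ρ₁ →
      ∀ (V : Type) [AddCommGroup V] [Module k V] (π : Representation k (GL (Fin 2) F) V)
        (ι : V₀ →ₗ[k] V),
        π.IsAdmissible → Function.Injective ι →
        (∀ (g : glIntCenter F 2) (v : V₀), ι (D₀ g v) = π g (ι v)) →
        (∀ (g : iwahoriNormalizerGL 2 F) (v : D₀.fixedPoints (proPIwahoriIn F 2)),
            ι (ρ₁ g v : D₀.fixedPoints (proPIwahoriIn F 2)) = π g (ι v)) →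
        (Representation.socle (π.comp (glInt 2 F).subtype)).toSubmodule =
          (Representation.socle
            (D₀.comp (Subgroup.inclusion (glInt_le_glIntCenter F 2)))).toSubmodule.map ι →
        Submodule.span k (Set.range fun gv : GL (Fin 2) F × V₀ => π gv.1 (ι gv.2)) = ⊤ →
        π.IsIrreducible

/-- **Discharge of `BreuilPaskunas2012_basicDiagramIrreducible`** (BP Thm. 1.2 (ii)) from the
general criterion `isIrreducible_of_isIrreducibleBasicDiagram` (BP Thm. 9.12, `e = 0`): an
admissible `π` is smooth, and (a) `soc_K π = ι(soc_K D₀)` puts `soc_K π` inside `ι(D₀)`.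
[cite: BreuilPaskunas2012, Thm. 1.2] -/
theorem BreuilPaskunas2012_basicDiagramIrreducible_holds :
    BreuilPaskunas2012_basicDiagramIrreducible := by
  intro p _ F _ _ _ _ _ k _ _ _ V₀ _ _ _ D₀ _ _ _ ρ₁ _ hD V _ _ π ι hπ hι hι₀ hι₁ hsoc hgen
  exact isIrreducible_of_isIrreducibleBasicDiagram hD π hπ.isSmooth ι hι hι₀ hι₁
    (hsoc.le.trans LinearMap.map_le_range) hgen

end Literature.NumberTheory.Automorphic
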